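import Summits.CriticalPhenomena.PercolationContinuityZ3.Theorems.Transplant.SkelFrmFromBParamsFaceOriginsXTA
import Summits.CriticalPhenomena.PercolationContinuityZ3.Theorems.Transplant.SkelFrmBParamsFaceOriginsXTA
import Summits.CriticalPhenomena.PercolationContinuityZ3.Theorems.Transplant.PlanarSkeletonFrmQuasiDefs
import Summits.CriticalPhenomena.PercolationContinuityZ3.Theorems.Transplant.PlanarSkeletonFrmDefs
import Summits.CriticalPhenomena.PercolationContinuityZ3.Theorems.Transplant.SkelPhiStepIDataNS
import Summits.CriticalPhenomena.PercolationContinuityZ3.Theorems.Transplant.SkelFrmQuasiBParamsFaceOriginsXA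
import Summits.CriticalPhenomena.PercolationContinuityZ3.Theorems.Transplant.SkelFrmQuasi1SlotTypes
import HarnessLib
import Summits.CriticalPhenomena.PercolationContinuityZ3.Theorems.Transplant.SkelFrmBParamsFaceOriginsXLA
/-!
# GEN-Q PORT (WAVE-Q table v0.8 section 2, row G189, U-level L19; captain R-6/R-7 2026-08-27: carrier token swap `PlanarSkeletonFrmFrom ↦ PlanarSkeletonFrmQuasi`)
# of the tree module «Transplant/SkelFrmFromBParamsFaceOriginsXLA» (sha256 85c4323c1a6d26ca…) onto the quasi-step carrier `PlanarSkeletonFrmQuasi` (p507026): «SkelFrmQuasiBParamsFaceOriginsXLA»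

ORIGINAL TITLE: (F) VALUE LAYER, N2 twin (hp-8 g42, 2026-08-23; F-DISCHARGE-MAP-N2 G18 x-face origins, the `|yL|₁ ≤ YbF` rows): `port_frm.py` text of N1

builds on p205010 (kernel theorem, internal audit signed; external expert review pending) — nothing in this file uses p205010; NOTHING is claimed about any open node
((N3-b), the end state).  Lane `prim-bschramm`, seat `prim-bschramm-stmt` (gen 33; GEN-Q column pen; tool = captain gen-1 g4's port_genq.py R-14 --cone + p3-g30's T1 patch).  Helper file (`--supports stmt-CriticalPhenomena-4575 --as helper`).
PORT RULES (U-wave r1–r4 re-used, GEN-Q hunk classes of p3-g29 #6136): declaration order, names and proof texts are those of «SkelFrmFromBParamsFaceOriginsXLA», byte-identical except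
(i) the carrier token `PlanarSkeletonFrmFrom ↦ PlanarSkeletonFrmQuasi` in binders, `namespace`/`end` lines and qualified names (module names `SkelFrmFrom… ↦ SkelFrmQuasi…`
in imports of already-ported rows); (ii) `Φ.step ↦ Φ.qstep` with the called Steps lemma replaced by its `…Q`/`_q` twin and the cost `Φ.M` threaded (none in this file unless
listed below); (iii) `Φ.cyl_connected ↦ Φ.cyl_reach` readers (none unless listed); (iv) graph-ball radii / window floors ×`Φ.M` (none unless listed).  Carrier-free
residents stay imported/exported from the original «SkelFrmBParamsFaceOriginsXLA» exactly as in the FrmFrom port.  Docstrings and citations are the original's.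

-/

noncomputable section

open scoped Classical

namespace Summit.CriticalPhenomena.PercolationContinuityZ3.Theorems.Transplant

namespace PlanarSkeletonFrmQuasi

namespace NegB

open Literature.Probability.Percolation Literature.Probability.LatticeModels SimpleGraph
open SkelConc (Consts)
open Skelφ (shearUnit shearUnit_pos sgnz sgnz_cases)
open Skelφ.StepI (DataN)
open Neg

namespace KS

section L1

/-- **`|yLXFs σ|₁ ≤ YbF`** (`|nBF| + |hBF| + ⌊(ℓ_L+ℓBF)/2⌋ ≤ S_F + ℓ_L`). [folklore] -/
theorem yLXFs_l1 (κ : Consts) {V : Type} [DecidableEq V] [Countable V] {G : SimpleGraph V} [G.LocallyFinite] (Φ : PlanarSkeletonFrmQuasi G) (t : V) (p : unitInterval) (D : Skelφ.StepI.DataNS V) (c : ℕ) (mk : ℕ) (gx : Neg.FSlot) (fx : Neg.FSlot) {σ : ℤ} (hσ : σ = 1 ∨ σ = -1) :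
    (yLXFs κ Φ t p D c mk (gT mk gx κ Φ t p D) (fT mk fx κ Φ t p D) σ 0).natAbs + (yLXFs κ Φ t p D c mk (gT mk gx κ Φ t p D) (fT mk fx κ Φ t p D) σ 1).natAbs ≤
      YbF κ Φ t p D c mk (gT mk gx κ Φ t p D) (fT mk fx κ Φ t p D) := by
  have h : (yLXFs κ Φ t p D c mk (gT mk gx κ Φ t p D) (fT mk fx κ Φ t p D) σ 0).natAbs + (yLXFs κ Φ t p D c mk (gT mk gx κ Φ t p D) (fT mk fx κ Φ t p D) σ 1).natAbs ≤
      nL κ Φ t p D (gT mk gx κ Φ t p D) (fT mk fx κ Φ t p D) + (hL κ Φ t p D (gT mk gx κ Φ t p D) (fT mk fx κ Φ t p D)).natAbs + ((nBF κ Φ t p D c mk : ℕ) : ℤ).natAbs +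
        (hBF κ Φ t p D c mk).natAbs + (mhXFs κ Φ t p D c mk (gT mk gx κ Φ t p D) (fT mk fx κ Φ t p D)).natAbs :=
    yLof_l1 κ Φ t p D _ _ hσ _ _ _
  obtain ⟨m1, m2⟩ := PlanarSkeletonNeg.NegB.RootArith.floor_sandwich (x := (ℓL κ Φ t p D (gT mk gx κ Φ t p D) (fT mk fx κ Φ t p D) : ℤ) + ℓBF κ Φ t p D c mk) (d := 2) (by norm_num)
  have em : mhXFs κ Φ t p D c mk (gT mk gx κ Φ t p D) (fT mk fx κ Φ t p D) = ((ℓL κ Φ t p D (gT mk gx κ Φ t p D) (fT mk fx κ Φ t p D) : ℤ) + ℓBF κ Φ t p D c mk) / 2 := rfl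
  rw [← em] at m1 m2
  have k1 : (((mhXFs κ Φ t p D c mk (gT mk gx κ Φ t p D) (fT mk fx κ Φ t p D)).natAbs : ℕ) : ℤ) ≤ (ℓL κ Φ t p D (gT mk gx κ Φ t p D) (fT mk fx κ Φ t p D) : ℤ) + ℓBF κ Φ t p D c mk := by
    rw [Int.natCast_natAbs, abs_of_nonneg (by omega)]; omega
  rw [Int.natAbs_natCast] at h
  have e : ((nL κ Φ t p D (gT mk gx κ Φ t p D) (fT mk fx κ Φ t p D) + (hL κ Φ t p D (gT mk gx κ Φ t p D) (fT mk fx κ Φ t p D)).natAbs + nBF κ Φ t p D c mk +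
        (hBF κ Φ t p D c mk).natAbs + (mhXFs κ Φ t p D c mk (gT mk gx κ Φ t p D) (fT mk fx κ Φ t p D)).natAbs : ℕ) : ℤ) ≤
      ((YbF κ Φ t p D c mk (gT mk gx κ Φ t p D) (fT mk fx κ Φ t p D) : ℕ) : ℤ) := by
    unfold YbF SF; push_cast [Int.natCast_natAbs] at k1 ⊢
    linarith [abs_nonneg (hL κ Φ t p D (gT mk gx κ Φ t p D) (fT mk fx κ Φ t p D)), abs_nonneg (hBF κ Φ t p D c mk)]
  exact h.trans (by exact_mod_cast e)

-- GEN-Q (R-2, captain 2026-08-27): `PlanarSkeletonFrmFrom.NegB.KS.yLXFd_l1` is not in the used cone of the node top — not ported.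

-- GEN-Q (R-2, captain 2026-08-27): `PlanarSkeletonFrmFrom.NegB.KS.yLXFt_l1` is not in the used cone of the node top — not ported.

end L1

end KS

end NegB

end PlanarSkeletonFrmQuasi

end Summit.CriticalPhenomena.PercolationContinuityZ3.Theorems.Transplant

end
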